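import Literature.Computability.Learning.NWPredictorFP
import Literature.Computability.Learning.ColumnDesignTables
import HarnessLib

/-!
# The table-based NW predictor in `FP` for a general column design

Machine-layer groundwork for the named fact `Literature.Computability.Learning.cikk_learn_AC0Mod`
(CIKK 2016, Cor. 5.4). `NWPredictorFP.lean` builds, for the prime-field design of the `P/poly`
learner, the string functions with which the hypothesis evaluator computes the NW predictor from
the TABLES (`predictOfTables`; CIKK §2.4, circuit construction). Its chain
`colValFn → maskPiece → matchMaskFn → hybPiece → hybFn → predFn` depends on the design only
through the COLUMN PROGRAM `colValFn`. This file factors that chain once over an arbitrary column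
program `cvF : List Bool → List Bool` with value function `cv` (`CvSpec cvF cv`: on
`⟨⟨hdr, vbits⟩, 1^τ⟩` the program returns the binary numeral of `cv q ℓ vbits τ`), on the record
layout of `NWPredictorFP.lean` (`predHdr`, `predRec`, whose design-independent bricks `mkCtxFn`,
`bitsOfFn`, `patFn`, `lookupFn`, the accessors and `wiFn` are reused):

* `maskPiece cvF`, `matchMaskFn cvF` (the indicator of `ColDesign.colMatch`), `hybPiece cvF`,
  `hybFn cvF`, `predFn cvF dR`, each `∈ FP` when `cvF ∈ FP`, with their values;
* **`predFn_eq_nwPredictor`**: for a column design `e` with column values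
  `cvFin cv q ℓ i τ = cv q ℓ (bits of i) τ` (`ColDesign.IsColumnDesign`, intersections `≤ ℓ`), on a
  genuine record whose stored tables are the `ColDesign.tableList`s of `g`, and `dR` deciding
  `truthTableLanguage R`, the value is `[nwPredictor e g (natTest R ℓ) i z w x]`.

Statements and proofs follow `NWPredictorFP.lean` line by line with `cvF` carried as a parameter.

## References

* M. Carmosino, R. Impagliazzo, V. Kabanets, A. Kolokolova, *Learning algorithms from natural
  proofs*, CCC 2016, §2.4 (NW reconstruction: circuit construction, steps 1–3)
  [CarmosinoImpagliazzoKabanetsKolokolova2016].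
* S. Arora, B. Barak, *Computational Complexity: A Modern Approach*, CUP 2009, §1.3 [AroraBarak2009].
-/

open Polynomial

namespace Literature.Computability.Learning

namespace ColDesign

open Literature.Computability.Complexity Literature.Computability.Complexity.Brick
  Literature.Computability.Complexity.Plumb Literature.Computability.MetaComplexity
  Literature.Computability.Cryptography _root_.Computability

/-! ### The column program and its specification -/

/-- **Specification of a column program**: on `⟨⟨predHdr pad q ℓ n' L, vbits⟩, 1^τ⟩` it returns the
binary numeral of the column value `cv q ℓ vbits τ`. [folklore] -/
def CvSpec (cvF : List Bool → List Bool) (cv : ℕ → ℕ → List Bool → ℕ → ℕ) : Prop :=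
  ∀ (pad : List Bool) (q ℓ n' L : ℕ) (vbits : List Bool) (τ : ℕ),
    cvF (boolPair (boolPair (predHdr pad q ℓ n' L) vbits) (ones τ)) = encodeNat (cv q ℓ vbits τ)

/-- The column values of the blocks `i < 2^ℓ` (read through their `ℓ` bits). [folklore] -/
def cvFin (cv : ℕ → ℕ → List Bool → ℕ → ℕ) (q ℓ : ℕ) (i : Fin (2 ^ ℓ)) (τ : ℕ) : ℕ :=
  cv q ℓ (List.ofFn ((boolFunEquivFin ℓ).symm i)) τ

variable (cvF : List Bool → List Bool) {cv : ℕ → ℕ → List Bool → ℕ → ℕ}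

/-! ### The matching mask of blocks `i` and `j` -/

/-- The piece of the mask fold on `⟨⟨hdr, ⟨ibits, jbits⟩⟩, 1^τ⟩`: the bit `[A_i(τ) ≡ A_j(τ)]`.
[folklore] -/
noncomputable def maskPiece : List Bool → List Bool :=
  eqValFn ∘ fanoutFn
    (cvF ∘ fanoutFn (fanoutFn (fstF ∘ fstF) (nthF 1 ∘ fstF)) sndF)
    (cvF ∘ fanoutFn (fanoutFn (fstF ∘ fstF) (sndPow 1 ∘ fstF)) sndF)

/-- `maskPiece ∈ FP`. [folklore] -/
theorem maskPiece_mem_FP (hcv : cvF ∈ FP) : maskPiece cvF ∈ FP :=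
  comp_mem_FP eqValFn_mem_FP (fanoutFn_mem_FP
    (comp_mem_FP hcv (fanoutFn_mem_FP
      (fanoutFn_mem_FP (comp_mem_FP fstF_mem_FP fstF_mem_FP) (comp_mem_FP (nthF_mem_FP 1) fstF_mem_FP)) sndF_mem_FP))
    (comp_mem_FP hcv (fanoutFn_mem_FP
      (fanoutFn_mem_FP (comp_mem_FP fstF_mem_FP fstF_mem_FP) (comp_mem_FP (sndPow_mem_FP 1) fstF_mem_FP)) sndF_mem_FP)))

/-- Value of `maskPiece`. [folklore] -/
theorem maskPiece_apply (hcv_apply : CvSpec cvF cv) (pad : List Bool) (q ℓ n' L : ℕ) (ibits jbits : List Bool) (τ : ℕ) :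
    maskPiece cvF (boolPair (boolPair (predHdr pad q ℓ n' L) (boolPair ibits jbits)) (ones τ)) =
      [decide (cv q ℓ ibits τ = cv q ℓ jbits τ)] := by
  rw [maskPiece, Function.comp_apply, fanoutFn_apply]
  simp only [Function.comp_apply, fanoutFn_apply, fstF_boolPair, sndF_boolPair, nthF, sndPow,
    hcv_apply pad q ℓ n' L, eqValFn_boolPair, bitsToNat_encodeNat]

/-- The mask pieces are single bits (on every input, `eqValFn` is one-bit). [folklore] -/
theorem length_maskPiece (w : List Bool) : (maskPiece cvF w).length = 1 := by
  rw [maskPiece, Function.comp_apply]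
  exact oneBit_eqValFn.length_eq _

/-- **The matching mask** on `⟨hdr, ⟨ibits, jbits⟩⟩`: the `n'` bits `[A_i(τ) ≡ A_j(τ) (mod q)]`.
[cite: CarmosinoImpagliazzoKabanetsKolokolova2016, §2.4] -/
noncomputable def matchMaskFn : List Bool → List Bool :=
  sndPow 2 ∘ foldLoop appF (clipF 1 (maskPiece cvF)) X ∘
    fanoutFn id (fanoutFn (lenBinF ∘ nthF 3 ∘ fstF) (fun _ => boolPair [] []))

/-- `matchMaskFn ∈ FP`. [folklore] -/
theorem matchMaskFn_mem_FP (hcv : cvF ∈ FP) : matchMaskFn cvF ∈ FP :=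
  comp_mem_FP (sndPow_mem_FP 2) (comp_mem_FP
    (foldLoop_clipF_mem_FP 1 appF_mem_FP length_appF_le (maskPiece_mem_FP cvF hcv) X)
    (fanoutFn_mem_FP (PolyTimeComputable.id _)
      (fanoutFn_mem_FP (comp_mem_FP lenBinF_mem_FP (comp_mem_FP (nthF_mem_FP 3) fstF_mem_FP)) (const_mem_FP _))))

/-- Value of `matchMaskFn`. [folklore] -/
theorem matchMaskFn_apply (hcv_apply : CvSpec cvF cv) (pad : List Bool) (q ℓ n' L : ℕ) (ibits jbits : List Bool) :
    matchMaskFn cvF (boolPair (predHdr pad q ℓ n' L) (boolPair ibits jbits)) =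
      ccat (fun τ => [decide (cv q ℓ ibits τ = cv q ℓ jbits τ)]) n' := by
  have hn : n' ≤ X.eval (boolPair (predHdr pad q ℓ n' L) (boolPair ibits jbits)).length := by
    rw [eval_X, length_boolPair]
    have : n' ≤ (predHdr pad q ℓ n' L).length := by
      simp only [predHdr, length_boolPair]
      have : (ones n').length = n' := by simp [ones]
      omega
    omega
  have hnth : nthF 3 (predHdr pad q ℓ n' L) = ones n' := by simp [predHdr, nthF]
  rw [matchMaskFn, Function.comp_apply, Function.comp_apply, fanoutFn_apply, fanoutFn_apply, id,
    Function.comp_apply, Function.comp_apply, fstF_boolPair, hnth, lenBinF_apply,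
    show (ones n').length = n' by simp [ones],
    show (boolPair ([] : List Bool) []) = boolPair (ones 0) ([] : List Bool) by rfl,
    foldLoop_apply _ _ hn, foldAcc_clipF (fun j _ _ => by rw [length_maskPiece cvF]; omega), foldAcc_appF]
  simp [sndPow, maskPiece_apply cvF hcv_apply]

/-! ### The hybrid string and the predictor -/

/-- **The piece of the hybrid fold** at index `j`: a table look-up at the pattern of `x` for
`j < i`, the advice bit `w_j` for `j ≥ i`. [cite: CarmosinoImpagliazzoKabanetsKolokolova2016, §2.4 (circuit construction)] -/
noncomputable def hybPiece : List Bool → List Bool :=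
  iteFn (ltLenF ∘ fanoutFn sndF onesiW)
    (lookupFn ∘ fanoutFn (fanoutFn onesLW (fanoutFn sndF tablesW))
      (patFn ∘ fanoutFn (matchMaskFn cvF ∘ fanoutFn hdrW (fanoutFn ibitsW jbitsW)) xbitsW))
    (bitAtFn ∘ fanoutFn sndF wbitsW)

/-- `hybPiece ∈ FP`. [folklore] -/
theorem hybPiece_mem_FP (hcv : cvF ∈ FP) : hybPiece cvF ∈ FP := by
  obtain ⟨-, hH, hL, -, hI, hW, hT, hX, hi, hj⟩ := accessors_mem_FP
  exact iteFn_mem_FP (comp_mem_FP ltLenF_mem_FP (fanoutFn_mem_FP sndF_mem_FP hi))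
    (comp_mem_FP lookupFn_mem_FP (fanoutFn_mem_FP (fanoutFn_mem_FP hL (fanoutFn_mem_FP sndF_mem_FP hT))
      (comp_mem_FP patFn_mem_FP (fanoutFn_mem_FP
        (comp_mem_FP (matchMaskFn_mem_FP cvF hcv) (fanoutFn_mem_FP hH (fanoutFn_mem_FP hI hj))) hX))))
    (comp_mem_FP bitAtFn_mem_FP (fanoutFn_mem_FP sndF_mem_FP hW))

/-- **Value of `hybPiece`** on a genuine argument (`⟦ibits⟧ < L`, `j < 2^ℓ`). [folklore] -/
theorem hybPiece_apply (pad : List Bool) (q ℓ n' L : ℕ) (ibits wbits : List Bool) (tbls : List (List Bool))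
    (zbits xbits : List Bool) (hi : bitsToNat ibits < L) (j : ℕ) :
    hybPiece cvF (boolPair (boolPair (predRec (predHdr pad q ℓ n' L) ibits wbits (OracleCompose.body tbls) zbits)
      xbits) (ones j)) =
      if j < bitsToNat ibits then
        ((tbls.getD j []).drop (min (bitsToNat (patFn (boolPair
          (matchMaskFn cvF (boolPair (predHdr pad q ℓ n' L) (boolPair ibits (List.ofFn fun r : Fin ℓ => j.testBit r))))
          xbits))) L)).take 1
      else (wbits.drop j).take 1 := by
  have hacc : ∀ u : List Bool,
      let w := boolPair (boolPair (predRec (predHdr pad q ℓ n' L) ibits wbits (OracleCompose.body tbls) zbits)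
        xbits) u
      PofW w = predRec (predHdr pad q ℓ n' L) ibits wbits (OracleCompose.body tbls) zbits ∧
      hdrW w = predHdr pad q ℓ n' L ∧ onesLW w = ones L ∧ onesEllW w = ones ℓ ∧ ibitsW w = ibits ∧
      wbitsW w = wbits ∧ tablesW w = OracleCompose.body tbls ∧ xbitsW w = xbits ∧ onesiW w = ones (bitsToNat ibits) := by
    intro u
    simp only [PofW, hdrW, onesLW, onesEllW, ibitsW, wbitsW, tablesW, xbitsW, onesiW, Function.comp_apply,
      fanoutFn_apply, fstF_boolPair, sndF_boolPair, predRec, predHdr, nthF, sndPow, binToUnaryFn_boolPair,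
      List.length_replicate, ones, min_eq_left hi.le, and_self]
  obtain ⟨hP, hH, hL, hE, hI, hW, hT, hX, hii⟩ := hacc (ones j)
  have hjb : jbitsW (boolPair (boolPair (predRec (predHdr pad q ℓ n' L) ibits wbits (OracleCompose.body tbls) zbits)
      xbits) (ones j)) = List.ofFn fun r : Fin ℓ => j.testBit r := by
    rw [jbitsW, Function.comp_apply, fanoutFn_apply, hE, sndF_boolPair, bitsOfFn_apply]
  rw [hybPiece, iteFn_apply (b := decide (j < bitsToNat ibits)) (by
    rw [Function.comp_apply, fanoutFn_apply, sndF_boolPair, hii, ltLenF_boolPair]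
    simp [ones])]
  by_cases hlt : j < bitsToNat ibits
  · rw [if_pos hlt, decide_eq_true hlt]
    simp only [ite_true, Function.comp_apply, fanoutFn_apply, hL, sndF_boolPair, hT, hH, hI, hjb, hX,
      lookupFn_apply]
  · rw [if_neg hlt, decide_eq_false hlt]
    simp only [Function.comp_apply, fanoutFn_apply, sndF_boolPair, hW, bitAtFn_boolPair,
      List.length_replicate, ones, Bool.false_eq_true, ite_false]

/-- The hybrid pieces are at most one bit long on every input. [folklore] -/
theorem length_hybPiece_le (w : List Bool) : (hybPiece cvF w).length ≤ 1 := by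
  rw [hybPiece, iteFn_of_oneBit (oneBit_ltLenF.comp _)]
  split_ifs
  · rw [Function.comp_apply, lookupFn]
    simp only [Function.comp_apply, fanoutFn_apply, bitAtFn_boolPair]
    exact List.length_take_le _ _
  · rw [Function.comp_apply]
    simp only [fanoutFn_apply, bitAtFn_boolPair]
    exact List.length_take_le _ _

/-- **The hybrid string** on `Π = ⟨P, xbits⟩`: the `L` bits `H_j`, `j < L`.
[cite: CarmosinoImpagliazzoKabanetsKolokolova2016, §2.4 (circuit construction)] -/
noncomputable def hybFn : List Bool → List Bool :=
  sndPow 2 ∘ foldLoop appF (clipF 1 (hybPiece cvF)) X ∘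
    fanoutFn id (fanoutFn (lenBinF ∘ sndPow 3 ∘ fstF ∘ fstF) (fun _ => boolPair [] []))

/-- `hybFn ∈ FP`. [folklore] -/
theorem hybFn_mem_FP (hcv : cvF ∈ FP) : hybFn cvF ∈ FP :=
  comp_mem_FP (sndPow_mem_FP 2) (comp_mem_FP
    (foldLoop_clipF_mem_FP 1 appF_mem_FP length_appF_le (hybPiece_mem_FP cvF hcv) X)
    (fanoutFn_mem_FP (PolyTimeComputable.id _)
      (fanoutFn_mem_FP (comp_mem_FP lenBinF_mem_FP (comp_mem_FP (sndPow_mem_FP 3)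
        (comp_mem_FP fstF_mem_FP fstF_mem_FP))) (const_mem_FP _))))

/-- Value of `hybFn`: the concatenation of the hybrid pieces. [folklore] -/
theorem hybFn_apply (pad : List Bool) (q ℓ n' L : ℕ) (ibits wbits tables zbits xbits : List Bool) :
    hybFn cvF (boolPair (predRec (predHdr pad q ℓ n' L) ibits wbits tables zbits) xbits) =
      ccat (fun j => hybPiece cvF (boolPair (boolPair (predRec (predHdr pad q ℓ n' L) ibits wbits tables zbits)
        xbits) (ones j))) L := by
  have hL : L ≤ X.eval (boolPair (predRec (predHdr pad q ℓ n' L) ibits wbits tables zbits) xbits).length := by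
    rw [eval_X, length_boolPair]
    have : L ≤ (predRec (predHdr pad q ℓ n' L) ibits wbits tables zbits).length := by
      simp only [predRec, predHdr, length_boolPair]
      have : (ones L).length = L := by simp [ones]
      omega
    omega
  have hnth : sndPow 3 (fstF (predRec (predHdr pad q ℓ n' L) ibits wbits tables zbits)) = ones L := by
    simp [predRec, predHdr, sndPow]
  rw [hybFn, Function.comp_apply, Function.comp_apply, fanoutFn_apply, fanoutFn_apply, id,
    Function.comp_apply, Function.comp_apply, Function.comp_apply, fstF_boolPair, hnth, lenBinF_apply,
    show (ones L).length = L by simp [ones],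
    show (boolPair ([] : List Bool) []) = boolPair (ones 0) ([] : List Bool) by rfl,
    foldLoop_apply _ _ hL, foldAcc_clipF (fun j _ _ => (length_hybPiece_le cvF _).trans (by omega)), foldAcc_appF]
  simp [sndPow]

/-- **The table-based NW predictor** with the decision procedure `dR` of the property on truth
tables: answer `¬ w_i` if `dR` accepts the hybrid string (the test `natTest` REJECTS strings with
the property), `w_i` otherwise. [cite: CarmosinoImpagliazzoKabanetsKolokolova2016, §2.4 (circuit construction, step 3)] -/
noncomputable def predFn (dR : List Bool → List Bool) : List Bool → List Bool :=
  iteFn (HashBricks.headBitFn ∘ dR ∘ hybFn cvF) (notFn wiFn) wiFn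

/-- **`predFn dR ∈ FP`** for `dR ∈ FP`. [cite: AroraBarak2009, §1.3] -/
theorem predFn_mem_FP (hcv : cvF ∈ FP) {dR : List Bool → List Bool} (hdR : dR ∈ FP) : predFn cvF dR ∈ FP :=
  iteFn_mem_FP (comp_mem_FP HashBricks.headBitFn_mem_FP (comp_mem_FP hdR (hybFn_mem_FP cvF hcv)))
    (notFn_mem_FP wiFn_mem_FP) wiFn_mem_FP

/-- `predFn dR` is one-bit on every input. [folklore] -/
theorem oneBit_predFn (dR : List Bool → List Bool) : OneBit (predFn cvF dR) :=
  ((HashBricks.oneBit_headBitFn).comp _).ite (oneBit_notFn oneBit_wiFn) oneBit_wiFn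

/-- **Value of `predFn`** (string level): negate `w_i` iff `dR` accepts the hybrid string. [folklore] -/
theorem predFn_apply_str (dR : List Bool → List Bool) (pad : List Bool) (q ℓ n' L : ℕ)
    (ibits wbits tables zbits xbits : List Bool) (hi : bitsToNat ibits < L) :
    predFn cvF dR (boolPair (predRec (predHdr pad q ℓ n' L) ibits wbits tables zbits) xbits) =
      [xor ((dR (hybFn cvF (boolPair (predRec (predHdr pad q ℓ n' L) ibits wbits tables zbits) xbits))).headD false)
        ((wbits.drop (bitsToNat ibits)).headD false)] := by
  rw [predFn, iteFn_apply (b := (dR (hybFn cvF (boolPair (predRec (predHdr pad q ℓ n' L) ibits wbits tables zbits)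
      xbits))).headD false) (by rw [Function.comp_apply, Function.comp_apply, HashBricks.headBitFn_apply])]
  split_ifs with h
  · rw [notFn_apply (wiFn_apply pad q ℓ n' L ibits wbits tables zbits xbits hi), h]
    simp
  · rw [wiFn_apply pad q ℓ n' L ibits wbits tables zbits xbits hi]
    simp only [Bool.not_eq_true] at h
    rw [h]
    simp

/-! ### The bridge to the mathematical predictor -/

variable {cvF}

/-- The hybrid bits of the table-based predictor over the column design `e`, as a function. [folklore] -/
noncomputable def hybOfTables (cv : ℕ → ℕ → List Bool → ℕ → ℕ) (q : ℕ) {ℓ n' m : ℕ} (e : Fin (2 ^ ℓ) → (Fin n' ↪ Fin m))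
    (g : (Fin n' → Bool) → Bool) (i : Fin (2 ^ ℓ)) (z : Fin m → Bool) (w : Fin (2 ^ ℓ) → Bool) (x : Fin n' → Bool) :
    Fin (2 ^ ℓ) → Bool :=
  fun j => if (j : ℕ) < i then
    (tableList (cvFin cv q ℓ) e g i j z).getD (idxOf (cvFin cv q ℓ) n' i j x) false else w j

/-- **Each hybrid piece of the machine is the hybrid bit.** [cite: CarmosinoImpagliazzoKabanetsKolokolova2016, §2.4] -/
theorem hybPiece_eq (hcv_apply : CvSpec cvF cv) {q ℓ n' m : ℕ} {e : Fin (2 ^ ℓ) → (Fin n' ↪ Fin m)}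
    (he : IsColumnDesign (cvFin cv q ℓ) e) (hdes : IsNWDesign ℓ e) (pad : List Bool)
    (g : (Fin n' → Bool) → Bool) (i : Fin (2 ^ ℓ)) (z : Fin m → Bool)
    (w : Fin (2 ^ ℓ) → Bool) (x : Fin n' → Bool) (tbls : List (List Bool))
    (htbls : ∀ j : Fin (2 ^ ℓ), (j : ℕ) < i → tbls.getD j [] = tableList (cvFin cv q ℓ) e g i j z)
    (j : ℕ) (hj : j < 2 ^ ℓ) :
    hybPiece cvF (boolPair (boolPair (predRec (predHdr pad q ℓ n' (2 ^ ℓ))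
      (List.ofFn ((boolFunEquivFin ℓ).symm i)) (List.ofFn w) (OracleCompose.body tbls) (List.ofFn z))
      (List.ofFn x)) (ones j)) = [hybOfTables cv q e g i z w x ⟨j, hj⟩] := by
  classical
  have hival : bitsToNat (List.ofFn ((boolFunEquivFin ℓ).symm i)) = i := bitsToNat_ofFn_symm i
  have hi : bitsToNat (List.ofFn ((boolFunEquivFin ℓ).symm i)) < 2 ^ ℓ := by rw [hival]; exact i.isLt
  rw [hybPiece_apply cvF pad q ℓ n' (2 ^ ℓ) _ (List.ofFn w) tbls (List.ofFn z) (List.ofFn x) hi j, hival]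
  unfold hybOfTables
  by_cases hji : j < (i : ℕ)
  · rw [if_pos hji]
    simp only [hji, if_true]
    have hne : i ≠ ⟨j, hj⟩ := fun h => by rw [h] at hji; exact lt_irrefl _ hji
    -- the mask is the matching indicator
    have hmask : matchMaskFn cvF (boolPair (predHdr pad q ℓ n' (2 ^ ℓ))
        (boolPair (List.ofFn ((boolFunEquivFin ℓ).symm i)) (List.ofFn fun r : Fin ℓ => j.testBit r))) =
        List.ofFn fun τ : Fin n' => decide (colMatch (cvFin cv q ℓ) i ⟨j, hj⟩ τ) := by
      rw [matchMaskFn_apply cvF hcv_apply, ofFn_testBit_eq hj]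
      exact ccat_singleton_eq_ofFn (fun τ => decide (colMatch (cvFin cv q ℓ) i ⟨j, hj⟩ τ)) n'
    -- the pattern value is `idxOf`
    have hpat : bitsToNat (patFn (boolPair (matchMaskFn cvF (boolPair (predHdr pad q ℓ n' (2 ^ ℓ))
        (boolPair (List.ofFn ((boolFunEquivFin ℓ).symm i)) (List.ofFn fun r : Fin ℓ => j.testBit r))))
        (List.ofFn x))) = idxOf (cvFin cv q ℓ) n' i ⟨j, hj⟩ x := by
      rw [hmask, patFn_apply, List.length_ofFn,
        ccat_congr (g' := fun τ => if colMatch (cvFin cv q ℓ) i ⟨j, hj⟩ τ then [(List.ofFn x).getD τ false] else [])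
          (fun τ hτ => by
            rw [headD_drop_ofFn _ hτ]
            by_cases hc : colMatch (cvFin cv q ℓ) i ⟨j, hj⟩ τ
            · simp [hc, take_one_drop_ofFn _ hτ, hτ]
            · simp [hc]),
        ccat_ite_eq_filter_map, idxOf]
      congr 1
      rw [← List.map_coe_finRange_eq_range, List.filter_map, List.map_map]
      congr 1
      funext τ
      simp
    rw [hpat, htbls ⟨j, hj⟩ hji]
    have hidx : idxOf (cvFin cv q ℓ) n' i ⟨j, hj⟩ x < (tableList (cvFin cv q ℓ) e g i ⟨j, hj⟩ z).length := by
      rw [tableList, List.length_ofFn]; exact idxOf_lt (cvFin cv q ℓ) i ⟨j, hj⟩ x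
    have hidxL : idxOf (cvFin cv q ℓ) n' i ⟨j, hj⟩ x ≤ 2 ^ ℓ :=
      (idxOf_lt (cvFin cv q ℓ) i ⟨j, hj⟩ x).le.trans (Nat.pow_le_pow_right (by norm_num) (card_matching_le he hdes hne))
    rw [min_eq_left hidxL, List.take_one_drop_eq_of_lt_length hidx, List.getD_eq_getElem _ _ hidx]
    rfl
  · rw [if_neg hji]
    simp only [hji, if_false]
    exact take_one_drop_ofFn w hj

/-- **The machine predictor is the NW predictor.** On the record of the challenge block `i` (its
`ℓ` bits), the advice `w`, the list code of tables whose `j`-th item is the table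
`ColDesign.tableList … i j z` of block `j`, and the seed, with `dR` deciding the property on truth
tables (`dR y = encodeBool [y ∈ truthTableLanguage R]`), `predFn cvF dR ⟨P, x⟩ = [nwPredictor e g (natTest R ℓ) i z w x]`
for every column design `e` with column values `cvFin cv q ℓ` and intersections `≤ ℓ`.
[cite: CarmosinoImpagliazzoKabanetsKolokolova2016, Thm. 2.11 (reconstruction algorithm)] -/
theorem predFn_eq_nwPredictor (hcv_apply : CvSpec cvF cv) {q ℓ n' m : ℕ} {e : Fin (2 ^ ℓ) → (Fin n' ↪ Fin m)}
    (he : IsColumnDesign (cvFin cv q ℓ) e) (hdes : IsNWDesign ℓ e) (R : CombinatorialProperty)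
    {dR : List Bool → List Bool} (hdR : ∀ y, dR y = encodeBool ((truthTableLanguage R).boolIndicator y))
    (pad : List Bool) (g : (Fin n' → Bool) → Bool) (i : Fin (2 ^ ℓ)) (z : Fin m → Bool)
    (w : Fin (2 ^ ℓ) → Bool) (x : Fin n' → Bool) (tbls : List (List Bool))
    (htbls : ∀ j : Fin (2 ^ ℓ), (j : ℕ) < i → tbls.getD j [] = tableList (cvFin cv q ℓ) e g i j z) :
    predFn cvF dR (boolPair (predRec (predHdr pad q ℓ n' (2 ^ ℓ))
      (List.ofFn ((boolFunEquivFin ℓ).symm i)) (List.ofFn w) (OracleCompose.body tbls) (List.ofFn z))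
      (List.ofFn x)) = [nwPredictor e g (natTest R ℓ) i z w x] := by
  classical
  have hival : bitsToNat (List.ofFn ((boolFunEquivFin ℓ).symm i)) = i := bitsToNat_ofFn_symm i
  have hi : bitsToNat (List.ofFn ((boolFunEquivFin ℓ).symm i)) < 2 ^ ℓ := by rw [hival]; exact i.isLt
  -- the hybrid string is `ofFn hyb`
  have hstr : hybFn cvF (boolPair (predRec (predHdr pad q ℓ n' (2 ^ ℓ)) (List.ofFn ((boolFunEquivFin ℓ).symm i))
      (List.ofFn w) (OracleCompose.body tbls) (List.ofFn z)) (List.ofFn x)) = List.ofFn (hybOfTables cv q e g i z w x) := by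
    rw [hybFn_apply, ccat_congr (g' := fun j => [if h : j < 2 ^ ℓ then hybOfTables cv q e g i z w x ⟨j, h⟩ else false])
      (fun j hj => by rw [hybPiece_eq hcv_apply he hdes pad g i z w x tbls htbls j hj, dif_pos hj]), ccat_singleton_eq_ofFn]
    exact congrArg List.ofFn (funext fun j => by rw [dif_pos j.isLt])
  rw [predFn_apply_str cvF dR pad q ℓ n' (2 ^ ℓ) _ (List.ofFn w) (OracleCompose.body tbls) (List.ofFn z)
    (List.ofFn x) hi, hstr, hdR, hival, headD_drop_ofFn w i.isLt,
    nwPredictor_eq_predictOfTables he (natTest R ℓ) i z w x g]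
  have hmem : (List.ofFn (hybOfTables cv q e g i z w x) ∈ truthTableLanguage R) ↔
      (hybOfTables cv q e g i z w x ∘ boolFunEquivFin ℓ) ∈ R ℓ := by
    rw [← truthTable_comp_boolFunEquivFin, truthTable_mem_truthTableLanguage_iff]
  rw [show predictOfTables (natTest R ℓ) i (fun j => tableList (cvFin cv q ℓ) e g i j z)
      (fun j => idxOf (cvFin cv q ℓ) n' i j x) w =
      (if natTest R ℓ (hybOfTables cv q e g i z w x) = true then w i else !(w i)) from rfl]
  have henc : ∀ b : Bool, (encodeBool b).headD false = b := fun b => by cases b <;> rfl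
  rw [henc]
  unfold natTest
  by_cases hm : (hybOfTables cv q e g i z w x ∘ boolFunEquivFin ℓ) ∈ R ℓ
  · rw [(Set.mem_iff_boolIndicator _ _).1 (hmem.2 hm), (propertyTest_eq_true_iff R ℓ _).2 hm]
    simp
  · have h1 : (truthTableLanguage R).boolIndicator (List.ofFn (hybOfTables cv q e g i z w x)) = false := by
      cases hb : (truthTableLanguage R).boolIndicator (List.ofFn (hybOfTables cv q e g i z w x))
      · rfl
      · exact absurd (hmem.1 ((Set.mem_iff_boolIndicator _ _).2 hb)) hm
    have h2 : propertyTest R ℓ (hybOfTables cv q e g i z w x ∘ boolFunEquivFin ℓ) = false := by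
      cases hpt : propertyTest R ℓ (hybOfTables cv q e g i z w x ∘ boolFunEquivFin ℓ)
      · rfl
      · exact absurd ((propertyTest_eq_true_iff R ℓ _).1 hpt) hm
    rw [h1, h2]
    simp

end ColDesign

end Literature.Computability.Learning
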